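import Mathlib.Analysis.Fourier.FiniteAbelian.PontryaginDuality
import Mathlib.Data.ZMod.Basic
import Literature.Computability.AlgebraicComplexity.GlynnMultilinearSigmaPiSigma
import HarnessLib

/-!
# The syndrome polynomial of a labelled square matrix of variables

Topic `Literature/Computability/AlgebraicComplexity` (exact expressions for the permanent
modulo monomial ideals; the group-algebra device of Koutis–Williams). Definition file requested
by route `ValiantsHypothesis/ForgivenCollisions` (item `defn-syndromePoly`), whose support items
`SyndromeRepresentative`, `CounterRepresentative`, `SyndromeUpperBound` inline this object.

Fix `n`, an additive commutative monoid `G` and a labelling `g : Fin n → G` of the columns. A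
row-to-column map `j : Fin n → Fin n` selects the *one-variable-per-row* monomial
`∏_i X_{(i, j i)}` (exponent vector `graphMonomial j`, file `GlynnMultilinearSigmaPiSigma`);
its **syndrome** is `∑_i g (j i) = ∑_c #j⁻¹(c) • g c`, and the permutations are exactly the
maps hitting every column once, so every permutation has the syndrome `∑_c g c`.

* `syndromeMaps g` — the finset of maps `j` with `∑_i g (j i) = ∑_c g c`;
* `syndromePoly k g = ∑_{j ∈ syndromeMaps g} ∏_i X_{(i, j i)} : MvPolynomial (Fin n × Fin n) k`
  — the `0/1` sum of the selected monomials. It is the coefficient of the group element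
  `∑_c g c` in `∏_i (∑_j g(j) · x_{ij}) ∈ k[G][x]` (the Koutis–Williams group-algebra device),
  i.e. the polynomial `∑_{α ∈ T} x^α` of Pratt 2019, Thm. 53 for `y_{(i,j)} = g(j) - g(i)`,
  restricted to one-variable-per-row exponents. For `G = (ℤ/2)^n` and `g` the standard basis
  it is `per_n` itself and the character expansion below is Glynn's formula (Glynn 2010); for
  `G` trivial it is `∏_i ∑_j x_{ij}`; for `G = ℤ/n`, `g c = c` it is the mod-`n` counter of
  `CounterRepresentative`.

API: the literal filter-sums of the route (`sum_filter_eq_syndromePoly`, any decidability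
instance; `sum_filter_natMod_eq_syndromePoly` for the `ℤ/n` counter written with `% n` on
`ℕ`-casts), coefficients (`coeff_syndromePoly`, `= 1` on every permutation monomial, `= 0` off
the selected graph monomials), `support_syndromePoly`, the split `syndromePoly = perPoly +
(non-bijective selected maps)` (`syndromePoly_eq_perPoly_add`), constant labellings / trivial
group (`syndromePoly_const` : `∏_i ∑_j X_{ij}`), and the **character expansion** over `ℂ` for
finite abelian `G` (`syndromePoly_eq_smul_sum_addChar`):
`f_g = |G|⁻¹ ∑_{χ ∈ Ĝ} χ(-s) ∏_i ∑_j χ(g j) X_{ij}`, `s = ∑_c g c` — a `ΣΠΣ` expression with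
`|G|` products of linear forms (Pratt 2019, proof of Thm. 53: the regular representation of
`ℂ[G]` is diagonalised by the characters; Mathlib `AddChar.sum_apply_eq_ite`).
Not here: `syndromePoly - perPoly ∈ J_r` under a Sidon-type hypothesis on `g` (that is the
route item `SyndromeRepresentative`), complexity bounds, positive characteristic.

## References

* [Pratt2019] K. Pratt, *Waring rank, parameterized and exact algorithms*, FOCS 2019
  (arXiv:1807.06194), Thm. 53 and its proof (abelian group algebras; support rank `≤ |G|`).
* [KoutisWilliams2009] I. Koutis, R. Williams, *Limits and applications of group algebras for
  parameterized problems*, ICALP 2009, LNCS 5555, 653–664 (the group-algebra device).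
* [Glynn2010] D. G. Glynn, *The permanent of a square matrix*, European J. Combin. 31 (2010)
  1887–1891 (the case `G = (ℤ/2)^n`).
-/

noncomputable section

open MvPolynomial
open scoped BigOperators

namespace Literature.Computability.AlgebraicComplexity

/-! ### Graph monomials: row and column counts, the permanent in row form -/

section GraphMonomial

variable {n : ℕ}

/-- A one-variable-per-row monomial `∏_i X_{(i, τ i)}` has every row count `1`. [folklore] -/
theorem rowCount_graphMonomial (τ : Fin n → Fin n) (i : Fin n) :
    rowCount (graphMonomial τ) i = 1 := by
  simp only [rowCount, graphMonomial_apply]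
  rw [Finset.sum_ite_eq]
  simp

/-- A one-variable-per-row monomial `∏_i X_{(i, τ i)}` has column counts `#τ⁻¹(c)`. [folklore] -/
theorem colCount_graphMonomial (τ : Fin n → Fin n) (c : Fin n) :
    colCount (graphMonomial τ) c = (Finset.univ.filter fun i => τ i = c).card := by
  simp only [colCount, graphMonomial_apply]
  rw [Finset.card_filter]

variable (k : Type*) [CommSemiring k]

/-- `∏_i X_{(i, τ i)} = X^{graphMonomial τ}`. [folklore] -/
theorem prod_X_eq_monomial_graphMonomial (τ : Fin n → Fin n) :
    ∏ i, (X (i, τ i) : MvPolynomial (Fin n × Fin n) k) = monomial (graphMonomial τ) 1 := by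
  rw [graphMonomial, monomial_sum_one]
  rfl

/-- The permutations, viewed as self-maps, are exactly the bijective self-maps. [folklore] -/
theorem univ_map_permCoe_eq_filter_bijective :
    (Finset.univ : Finset (Equiv.Perm (Fin n))).map
        ⟨fun σ : Equiv.Perm (Fin n) => (⇑σ : Fin n → Fin n), DFunLike.coe_injective⟩ =
      Finset.univ.filter fun j : Fin n → Fin n => Function.Bijective j := by
  ext j
  simp only [Finset.mem_map, Finset.mem_univ, true_and, Function.Embedding.coeFn_mk,
    Finset.mem_filter]
  exact ⟨fun ⟨σ, hσ⟩ => hσ ▸ σ.bijective, fun hj => ⟨Equiv.ofBijective j hj, rfl⟩⟩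

/-- `per_n = ∑_σ ∏_i X_{(σ i, i)} = ∑_σ ∏_i X_{(i, σ⁻¹ i)}`: the permanent in
one-variable-per-row form. [folklore] -/
theorem perPoly_eq_sum_perm_prod_X :
    perPoly (Fin n) k =
      ∑ σ : Equiv.Perm (Fin n), ∏ i, (X (i, σ.symm i) : MvPolynomial (Fin n × Fin n) k) := by
  rw [perPoly_eq_sum_monomial]
  refine Finset.sum_congr rfl fun σ _ => ?_
  rw [permMonomial_eq_graphMonomial]
  exact (prod_X_eq_monomial_graphMonomial k _).symm

/-- `per_n = ∑_{j bijective} ∏_i X_{(i, j i)}`: the permanent is the sum of the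
one-variable-per-row monomials of the bijective row-to-column maps. [folklore] -/
theorem perPoly_eq_sum_filter_bijective :
    perPoly (Fin n) k =
      ∑ j ∈ Finset.univ.filter (fun j : Fin n → Fin n => Function.Bijective j),
        ∏ i, (X (i, j i) : MvPolynomial (Fin n × Fin n) k) := by
  rw [← univ_map_permCoe_eq_filter_bijective, Finset.sum_map, perPoly_eq_sum_perm_prod_X]
  exact Fintype.sum_equiv (Equiv.inv (Equiv.Perm (Fin n))) _ _ fun σ => rfl

end GraphMonomial

/-! ### Syndromes and the syndrome polynomial -/

section Syndrome

variable {n : ℕ} {G : Type*} [AddCommMonoid G]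

/-- The syndrome `∑_i g (τ i)` of a row-to-column map only depends on its column counts:
`∑_i g (τ i) = ∑_c #τ⁻¹(c) • g c` (so a map with doubled columns `D`, empty columns `E` and all
other columns hit once has syndrome `∑_c g c + ∑_D g - ∑_E g`). [folklore] -/
theorem sum_label_eq_sum_colCount_smul (g : Fin n → G) (τ : Fin n → Fin n) :
    ∑ i, g (τ i) = ∑ c, colCount (graphMonomial τ) c • g c := by
  rw [← Finset.sum_fiberwise' Finset.univ τ g]
  refine Finset.sum_congr rfl fun c _ => ?_
  rw [Finset.sum_const, colCount_graphMonomial]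

/-- The row-to-column maps `j : Fin n → Fin n` whose **syndrome** `∑_i g (j i)` equals the
syndrome `∑_c g c` common to all permutations (route `ValiantsHypothesis/ForgivenCollisions`;
for a group `G`: the exponents `α ∈ T` of Pratt 2019, Thm. 53 taking one variable per row, for
`y_{(i,j)} = g j - g i ∈ k[G]`). Decidability is classical inside the definition (as in
`MvPolynomial.vars`); the filter form with any instance is `syndromeMaps_eq_filter`. [folklore] -/
def syndromeMaps (g : Fin n → G) : Finset (Fin n → Fin n) :=
  letI := Classical.decEq G
  Finset.univ.filter fun j => ∑ i, g (j i) = ∑ c, g c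

/-- `syndromeMaps g` is the filter of `Finset.univ` by the syndrome condition, whatever
decidability instance states the filter. [folklore] -/
theorem syndromeMaps_eq_filter (g : Fin n → G)
    {hdec : DecidablePred fun j : Fin n → Fin n => ∑ i, g (j i) = ∑ c, g c} :
    syndromeMaps g =
      @Finset.filter _ (fun j : Fin n → Fin n => ∑ i, g (j i) = ∑ c, g c) hdec Finset.univ := by
  unfold syndromeMaps
  congr

/-- Membership in `syndromeMaps`: the syndrome condition. [folklore] -/
@[simp]
theorem mem_syndromeMaps {g : Fin n → G} {j : Fin n → Fin n} :
    j ∈ syndromeMaps g ↔ ∑ i, g (j i) = ∑ c, g c := by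
  classical
  rw [syndromeMaps_eq_filter g (hdec := inferInstance), Finset.mem_filter]
  simp

/-- Every permutation has the permutation syndrome. [folklore] -/
theorem permCoe_mem_syndromeMaps (g : Fin n → G) (σ : Equiv.Perm (Fin n)) :
    (⇑σ : Fin n → Fin n) ∈ syndromeMaps g :=
  mem_syndromeMaps.2 (Equiv.sum_comp σ g)

/-- Every bijective row-to-column map has the permutation syndrome. [folklore] -/
theorem mem_syndromeMaps_of_bijective (g : Fin n → G) {j : Fin n → Fin n}
    (hj : Function.Bijective j) : j ∈ syndromeMaps g :=
  permCoe_mem_syndromeMaps g (Equiv.ofBijective j hj)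

/-- A constant labelling selects every map. [folklore] -/
theorem syndromeMaps_const (a : G) : syndromeMaps (fun _ : Fin n => a) = Finset.univ := by
  ext j
  simp

variable (k : Type*) [CommSemiring k]

/-- The **syndrome polynomial** of a column labelling `g : Fin n → G` over the coefficient
semiring `k`: `f_g = ∑_{j : ∑_i g (j i) = ∑_c g c} ∏_i X_{(i, j i)} ∈ k[X_{ij}]`, the `0/1` sum
of the one-variable-per-row monomials whose column multiset has the syndrome of a permutation
(route `ValiantsHypothesis/ForgivenCollisions`, items `SyndromeRepresentative`,
`CounterRepresentative`, `SyndromeUpperBound`). Equivalently: the coefficient of the group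
element `∑_c g c` in `∏_i ∑_j g(j) · X_{ij} ∈ k[G][X]` (the Koutis–Williams group-algebra
device; Pratt 2019, Thm. 53). It contains every permutation monomial with coefficient `1`,
is `∏_i ∑_j X_{ij}` for constant `g`, and over `ℂ` it is a sum of `|G|` products of linear
forms (`syndromePoly_eq_smul_sum_addChar`). [folklore] -/
def syndromePoly (g : Fin n → G) : MvPolynomial (Fin n × Fin n) k :=
  ∑ j ∈ syndromeMaps g, ∏ i, X (i, j i)

/-- Folding the route's literal expression: for ANY decidability instance on the syndrome
condition, `∑_{j ∈ univ.filter (syndrome)} ∏_i X_{(i, j i)} = syndromePoly k g` (the left-hand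
object of `ForgivenCollisions.SyndromeRepresentative`). [folklore] -/
theorem sum_filter_eq_syndromePoly (g : Fin n → G)
    {hdec : DecidablePred fun j : Fin n → Fin n => ∑ i, g (j i) = ∑ c, g c} :
    (∑ j ∈ @Finset.filter _ (fun j : Fin n → Fin n => ∑ i, g (j i) = ∑ c, g c) hdec
        Finset.univ, ∏ i, (X (i, j i) : MvPolynomial (Fin n × Fin n) k)) =
      syndromePoly k g := by
  rw [syndromePoly, syndromeMaps_eq_filter g (hdec := hdec)]

/-- Unfolding `syndromePoly` to the filter-sum with the ambient decidability instance. [folklore] -/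
theorem syndromePoly_eq_sum_filter (g : Fin n → G)
    [DecidablePred fun j : Fin n → Fin n => ∑ i, g (j i) = ∑ c, g c] :
    syndromePoly k g =
      ∑ j ∈ Finset.univ.filter (fun j : Fin n → Fin n => ∑ i, g (j i) = ∑ c, g c),
        ∏ i, (X (i, j i) : MvPolynomial (Fin n × Fin n) k) :=
  (sum_filter_eq_syndromePoly k g).symm

/-- `syndromePoly` as a sum of monomials `X^{graphMonomial j}` with coefficient `1`. [folklore] -/
theorem syndromePoly_eq_sum_monomial (g : Fin n → G) :
    syndromePoly k g = ∑ j ∈ syndromeMaps g, monomial (graphMonomial j) (1 : k) :=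
  Finset.sum_congr rfl fun j _ => prod_X_eq_monomial_graphMonomial k j

/-- The coefficients of the syndrome polynomial: `coeff d f_g = #{j ∈ syndromeMaps g :
graphMonomial j = d}` (at most one term is nonzero, `graphMonomial` being injective). [folklore] -/
theorem coeff_syndromePoly (g : Fin n → G) (d : (Fin n × Fin n) →₀ ℕ) :
    coeff d (syndromePoly k g) =
      ∑ j ∈ syndromeMaps g, if graphMonomial j = d then (1 : k) else 0 := by
  rw [syndromePoly_eq_sum_monomial, coeff_sum]
  simp_rw [coeff_monomial]

/-- Off the selected graph monomials every coefficient of `f_g` vanishes (in particular at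
every exponent not of the form `graphMonomial j`, e.g. with a row of degree `≠ 1`). [folklore] -/
theorem coeff_syndromePoly_eq_zero (g : Fin n → G) {d : (Fin n × Fin n) →₀ ℕ}
    (hd : ∀ j ∈ syndromeMaps g, graphMonomial j ≠ d) : coeff d (syndromePoly k g) = 0 := by
  rw [coeff_syndromePoly]
  exact Finset.sum_eq_zero fun j hj => if_neg (hd j hj)

/-- A selected map contributes its graph monomial with coefficient exactly `1`. [folklore] -/
theorem coeff_graphMonomial_syndromePoly_of_mem (g : Fin n → G) {j : Fin n → Fin n}
    (hj : j ∈ syndromeMaps g) : coeff (graphMonomial j) (syndromePoly k g) = 1 := by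
  rw [coeff_syndromePoly, Finset.sum_eq_single j]
  · rw [if_pos rfl]
  · intro j' _ hj'
    exact if_neg fun h => hj' (graphMonomial_injective h)
  · intro h
    exact absurd hj h

/-- A non-selected map's graph monomial has coefficient `0`. [folklore] -/
theorem coeff_graphMonomial_syndromePoly_of_not_mem (g : Fin n → G) {j : Fin n → Fin n}
    (hj : j ∉ syndromeMaps g) : coeff (graphMonomial j) (syndromePoly k g) = 0 :=
  coeff_syndromePoly_eq_zero k g fun _ hj' h => hj (graphMonomial_injective h ▸ hj')

/-- The coefficient of `∏_i X_{(i, τ i)}` in `f_g` is `[∑_i g (τ i) = ∑_c g c]`. [folklore] -/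
theorem coeff_graphMonomial_syndromePoly [DecidableEq G] (g : Fin n → G) (τ : Fin n → Fin n) :
    coeff (graphMonomial τ) (syndromePoly k g) = if ∑ i, g (τ i) = ∑ c, g c then 1 else 0 := by
  split_ifs with h
  · exact coeff_graphMonomial_syndromePoly_of_mem k g (mem_syndromeMaps.2 h)
  · exact coeff_graphMonomial_syndromePoly_of_not_mem k g fun h' => h (mem_syndromeMaps.1 h')

/-- Every permutation monomial `X^{μ_σ} = ∏_i X_{(σ i, i)} = ∏_i X_{(i, σ⁻¹ i)}` occurs in
`f_g` with coefficient `1` (as in `per_n`, `coeff_permMonomial_perPoly`). [folklore] -/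
theorem coeff_permMonomial_syndromePoly (g : Fin n → G) (σ : Equiv.Perm (Fin n)) :
    coeff (permMonomial σ) (syndromePoly k g) = 1 := by
  rw [permMonomial_eq_graphMonomial]
  exact coeff_graphMonomial_syndromePoly_of_mem k g (permCoe_mem_syndromeMaps g σ.symm)

/-- The support of `f_g` is the set of graph monomials of the selected maps (over a nontrivial
coefficient semiring); distinct maps give distinct monomials. [folklore] -/
theorem support_syndromePoly [Nontrivial k] (g : Fin n → G) :
    (syndromePoly k g).support =
      (syndromeMaps g).map ⟨graphMonomial, graphMonomial_injective⟩ := by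
  ext d
  rw [mem_support_iff, Finset.mem_map]
  constructor
  · intro h
    exact not_not.1 fun hne => h (coeff_syndromePoly_eq_zero k g fun j hj hd => hne ⟨j, hj, hd⟩)
  · rintro ⟨j, hj, rfl⟩
    rw [Function.Embedding.coeFn_mk, coeff_graphMonomial_syndromePoly_of_mem k g hj]
    exact one_ne_zero

/-- **The syndrome polynomial splits off the permanent**:
`f_g = per_n + ∑_{j ∈ syndromeMaps g, j not bijective} ∏_i X_{(i, j i)}` — every bijective map
is selected, and those terms are exactly `per_n` (`perPoly_eq_sum_filter_bijective`). The route
item `SyndromeRepresentative` says that the remaining terms lie in the collision ideal.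
[folklore] -/
theorem syndromePoly_eq_perPoly_add (g : Fin n → G) :
    syndromePoly k g = perPoly (Fin n) k +
      ∑ j ∈ (syndromeMaps g).filter (fun j => ¬ Function.Bijective j),
        ∏ i, (X (i, j i) : MvPolynomial (Fin n × Fin n) k) := by
  rw [perPoly_eq_sum_filter_bijective, syndromePoly,
    ← Finset.sum_filter_add_sum_filter_not (syndromeMaps g) fun j => Function.Bijective j]
  congr 2
  ext j
  simp only [Finset.mem_filter, Finset.mem_univ, true_and, and_iff_right_iff_imp]
  exact mem_syndromeMaps_of_bijective g

/-- A constant labelling (in particular any labelling in a trivial group) forgives every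
collision: `f = ∑_j ∏_i X_{(i, j i)} = ∏_i ∑_j X_{ij}`, the `r = 1` representative of the route.
[folklore] -/
theorem syndromePoly_const (a : G) :
    syndromePoly k (fun _ : Fin n => a) =
      ∏ i : Fin n, ∑ j : Fin n, (X (i, j) : MvPolynomial (Fin n × Fin n) k) := by
  rw [syndromePoly, syndromeMaps_const, Fintype.prod_sum]

/-- Over a trivial (subsingleton) group every labelling is constant: `f_g = ∏_i ∑_j X_{ij}`
(the requested `syndromePoly_unit`, e.g. `G = PUnit`). [folklore] -/
theorem syndromePoly_eq_prod_sum_of_subsingleton [Subsingleton G] (g : Fin n → G) :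
    syndromePoly k g = ∏ i : Fin n, ∑ j : Fin n, (X (i, j) : MvPolynomial (Fin n × Fin n) k) := by
  rw [show g = fun _ => 0 from funext fun _ => Subsingleton.elim _ _]
  exact syndromePoly_const k 0

/-- **The mod-`n` counter** (`ForgivenCollisions.CounterRepresentative`: `G = ℤ/n`, `g c = c`):
the route writes the syndrome condition as `(∑_i j i) % n = (∑_c c) % n` on `ℕ`-casts; that
filter-sum (with any decidability instance) is `syndromePoly k (fun c => ((c : ℕ) : ZMod n))`.
[folklore] -/
theorem sum_filter_natMod_eq_syndromePoly
    {hdec : DecidablePred fun j : Fin n → Fin n =>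
      (∑ i, (j i : ℕ)) % n = (∑ c : Fin n, (c : ℕ)) % n} :
    (∑ j ∈ @Finset.filter _
        (fun j : Fin n → Fin n => (∑ i, (j i : ℕ)) % n = (∑ c : Fin n, (c : ℕ)) % n) hdec
        Finset.univ, ∏ i, (X (i, j i) : MvPolynomial (Fin n × Fin n) k)) =
      syndromePoly k (fun c : Fin n => ((c : ℕ) : ZMod n)) := by
  rw [syndromePoly]
  refine Finset.sum_congr ?_ fun _ _ => rfl
  ext j
  simp only [Finset.mem_filter, Finset.mem_univ, true_and, mem_syndromeMaps]
  rw [← Nat.cast_sum, ← Nat.cast_sum, ZMod.natCast_eq_natCast_iff']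

end Syndrome

/-! ### The character expansion (Pratt 2019, proof of Thm. 53) -/

section Characters

variable {n : ℕ} {G : Type*}

/-- Additive characters turn finite sums into products (same statement as
`Literature.NumberTheory.GaussSums.DabrowskiFisher1997.addChar_map_sum_eq_prod`, restated here to
keep `p`-adic Gauss sums out of the import closure). [folklore] -/
theorem addChar_map_sum_eq_prod [AddCommMonoid G] {M : Type*} [CommMonoid M] {ι : Type*}
    (ψ : AddChar G M) (s : Finset ι) (x : ι → G) :
    ψ (∑ i ∈ s, x i) = ∏ i ∈ s, ψ (x i) := by
  induction s using Finset.cons_induction with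
  | empty => simp
  | cons a s ha ih => rw [Finset.sum_cons, Finset.prod_cons, AddChar.map_add_eq_mul, ih]

variable [AddCommGroup G]

/-- Expanding one character term: `∏_i ∑_j χ(g j) X_{ij} = ∑_τ χ(∑_i g (τ i)) ∏_i X_{(i, τ i)}`.
[cite: Pratt2019, Thm. 53 (proof)] -/
theorem prod_sum_addChar_smul_X (χ : AddChar G ℂ) (g : Fin n → G) :
    (∏ i : Fin n, ∑ j : Fin n, χ (g j) • (X (i, j) : MvPolynomial (Fin n × Fin n) ℂ)) =
      ∑ τ : Fin n → Fin n,
        χ (∑ i, g (τ i)) • ∏ i, (X (i, τ i) : MvPolynomial (Fin n × Fin n) ℂ) := by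
  rw [Fintype.prod_sum]
  refine Fintype.sum_congr _ _ fun τ => ?_
  rw [Finset.prod_smul, addChar_map_sum_eq_prod]

variable [Fintype G]

/-- **Character expansion of the syndrome polynomial** (the Fourier transform of the
group-algebra device; Pratt 2019, proof of Thm. 53 — the regular representation of `ℂ[G]` is
diagonalised by the characters, so extracting one coefficient costs `|G|` products of linear
forms): for a finite abelian group `G` and any labelling `g`,
`f_g = |G|⁻¹ • ∑_{χ : AddChar G ℂ} χ(-∑_c g c) • ∏_i ∑_j χ(g j) • X_{ij}`.
(Orthogonality `∑_χ χ(a) = |G| · [a = 0]` is Mathlib's `AddChar.sum_apply_eq_ite`; for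
`G = (ℤ/2)^n` and `g` the standard basis this is Glynn's formula, for `G = ℤ/n`, `g c = c` the
length-`n` DFT form of the mod-`n` counter.) This is the `ΣΠΣ` formula of top fan-in `|G|` used
by `ForgivenCollisions.SyndromeUpperBound`. [cite: Pratt2019, Thm. 53 (proof)] -/
theorem syndromePoly_eq_smul_sum_addChar (g : Fin n → G) :
    syndromePoly ℂ g = (Fintype.card G : ℂ)⁻¹ • ∑ χ : AddChar G ℂ,
      χ (-(∑ c, g c)) • ∏ i : Fin n, ∑ j : Fin n,
        χ (g j) • (X (i, j) : MvPolynomial (Fin n × Fin n) ℂ) := by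
  classical
  have h1 : ∀ χ : AddChar G ℂ,
      χ (-(∑ c, g c)) • (∏ i : Fin n, ∑ j : Fin n,
        χ (g j) • (X (i, j) : MvPolynomial (Fin n × Fin n) ℂ)) =
      ∑ τ : Fin n → Fin n, χ (∑ i, g (τ i) - ∑ c, g c) •
        ∏ i, (X (i, τ i) : MvPolynomial (Fin n × Fin n) ℂ) := by
    intro χ
    rw [prod_sum_addChar_smul_X, Finset.smul_sum]
    refine Fintype.sum_congr _ _ fun τ => ?_
    rw [smul_smul, ← AddChar.map_add_eq_mul, neg_add_eq_sub]
  have h2 : ∀ τ : Fin n → Fin n, ∑ χ : AddChar G ℂ, χ (∑ i, g (τ i) - ∑ c, g c) =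
      if ∑ i, g (τ i) = ∑ c, g c then (Fintype.card G : ℂ) else 0 := by
    intro τ
    rw [AddChar.sum_apply_eq_ite]
    exact if_congr sub_eq_zero rfl rfl
  have hcard : (Fintype.card G : ℂ) ≠ 0 := Nat.cast_ne_zero.2 Fintype.card_ne_zero
  symm
  calc (Fintype.card G : ℂ)⁻¹ • ∑ χ : AddChar G ℂ, χ (-(∑ c, g c)) • ∏ i : Fin n, ∑ j : Fin n,
          χ (g j) • (X (i, j) : MvPolynomial (Fin n × Fin n) ℂ)
      = (Fintype.card G : ℂ)⁻¹ • ∑ τ : Fin n → Fin n,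
          (∑ χ : AddChar G ℂ, χ (∑ i, g (τ i) - ∑ c, g c)) •
            ∏ i, (X (i, τ i) : MvPolynomial (Fin n × Fin n) ℂ) := by
        simp_rw [h1, Finset.sum_smul]
        rw [Finset.sum_comm]
    _ = ∑ τ : Fin n → Fin n, (if ∑ i, g (τ i) = ∑ c, g c then (1 : ℂ) else 0) •
            ∏ i, (X (i, τ i) : MvPolynomial (Fin n × Fin n) ℂ) := by
        rw [Finset.smul_sum]
        refine Fintype.sum_congr _ _ fun τ => ?_
        rw [h2, smul_smul]
        congr 1
        split_ifs
        · exact inv_mul_cancel₀ hcard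
        · exact mul_zero _
    _ = syndromePoly ℂ g := by
        simp_rw [ite_smul, one_smul, zero_smul]
        rw [← Finset.sum_filter]
        exact sum_filter_eq_syndromePoly ℂ g

end Characters

end Literature.Computability.AlgebraicComplexity
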